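import Summits.CriticalPhenomena.CardyFormulaZ2.Theorems.CardyBoundaryCoulombGasHalfPlaneMarkDensityLawFromHalfStrip
import Summits.CriticalPhenomena.CardyFormulaZ2.Theorems.CardyBoundaryCoulombGasHalfPlaneMarkDensityLawRigidityCorollaries
import Literature.Probability.Percolation.CardyFormulaConformalInvariance
import Summits.CriticalPhenomena.CardyFormulaZ2.Theorems.CardyBoundaryCoulombGasHalfPlaneMarkDensityLawWiredCardy
import Summits.CriticalPhenomena.CardyFormulaZ2.Theorems.CardyBoundaryCoulombGasHalfPlaneMarkDensityLawOneArmThirdOfCrux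

/-!
# Line `Sketch` — the half-strip target of route CardyPerronTeleport and the half-plane family
# (crux `HalfPlaneMarkDensityLaw`, stmt-CriticalPhenomena-5661, route CardyBoundaryCoulombGas)

Compositions of the half-strip exhaustion (`collinearCardy_of_halfStripCardyZ2`, file `…FromHalfStrip`)
with the landed theory of the line:

* `halfStripRigidity : CardyPerronTeleport.HalfStripRigidity` — the support item
  stmt-CriticalPhenomena-5181 of route CardyPerronTeleport BY NAME (half-strip exhaustion + rigidity,
  file `…Rigidity`): half-strip Cardy pins every universal conformal crossing limit to `F` on `(0,1)`.
* `cardyFormulaZ2_of_halfStripCardyZ2_of_uniqueConformalLimit` — hence the deciding theorem of route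
  CardyPerronTeleport needs only its two cruxes: `HalfStripCardyZ2 → UniqueConformalLimit → CardyFormulaZ2`.
* `halfPlaneWiredCardy_of_halfStripCardyZ2` (stmt-5178 ⟹ stmt-9321, target of route CardyTotalPositivity),
  `halfPlaneOneArmThird_of_halfStripCardyZ2` (stmt-5178 ⟹ stmt-5662, crux 6 of this route) and its
  CardyTotalPositivity copy: the whole half-plane family of the CardyFormulaZ2 routes hangs below the
  half-strip target.
-/

noncomputable section

namespace Summit.CriticalPhenomena.CardyFormulaZ2.Cruxes.HalfPlaneMarkDensityLaw.SketchLine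

open Summit.CriticalPhenomena.CardyFormulaZ2.Theses.CardyBoundaryCoulombGas
  (HalfPlaneMarkDensityLaw HalfPlaneOneArmThird)
open Summit.CriticalPhenomena.CardyFormulaZ2.Theses.CardyTotalPositivity (HalfPlaneWiredCardy)
open Summit.CriticalPhenomena.CardyFormulaZ2.Theses.CardyPerronTeleport
  (HalfStripCardyZ2 UniqueConformalLimit HalfStripRigidity HalfStripGlue HalfStripUniversality HalfStripCardyT)
open Summit.CriticalPhenomena.CardyFormulaZ2.Theses.CardyUniqueLimit (CardyRigidity)

/-- **stmt-CriticalPhenomena-5181 (`HalfStripRigidity`, route CardyPerronTeleport) BY NAME**: half-strip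
Cardy for bond-`ℤ²` pins every universal conformal crossing limit `f` to Cardy's `F` on `(0,1)`
(half-strip exhaustion to the collinear half-plane law, then rigidity by box exhaustion run backwards).
[folklore] -/
theorem halfStripRigidity : Summit.CriticalPhenomena.CardyFormulaZ2.Theses.CardyPerronTeleport.HalfStripRigidity :=
  fun h₀ f hf ↦ eqOn_cardyFunction_of_collinearCardy (collinearCardy_of_halfStripCardyZ2 h₀) f hf

/-- **Route CardyPerronTeleport needs only its two cruxes**:
`HalfStripCardyZ2 → UniqueConformalLimit → CardyFormulaZ2`. [folklore] -/
theorem cardyFormulaZ2_of_halfStripCardyZ2_of_uniqueConformalLimit :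
    Summit.CriticalPhenomena.CardyFormulaZ2.Theses.CardyPerronTeleport.HalfStripCardyZ2 →
      Summit.CriticalPhenomena.CardyFormulaZ2.Theses.CardyPerronTeleport.UniqueConformalLimit → _root_.CardyFormulaZ2 :=
  fun h₀ hU ↦ cardyFormulaZ2_of_collinearCardy_of_uniqueConformalLimit
    (collinearCardy_of_halfStripCardyZ2 h₀) hU

/-- **stmt-5178 ⟹ stmt-0746**: `HalfStripCardyZ2 → CardyUniqueLimit.CardyRigidity` (the shared
identification crux of nine routes). [folklore] -/
theorem cardyRigidity_of_halfStripCardyZ2 :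
    Summit.CriticalPhenomena.CardyFormulaZ2.Theses.CardyPerronTeleport.HalfStripCardyZ2 →
      Summit.CriticalPhenomena.CardyFormulaZ2.Theses.CardyUniqueLimit.CardyRigidity :=
  fun h ↦ cardyRigidity_of_collinearCardy (collinearCardy_of_halfStripCardyZ2 h)

/-- **stmt-CriticalPhenomena-14405 (`HalfStripGlue`, route CardyPerronTeleport) BY NAME**: half-strip
universality between site-`𝕋` and bond-`ℤ²` plus Smirnov's theorem read on `𝕋` half-strips give the
bond-`ℤ²` half-strip target — fed the PROVED tree discharge of Smirnov's theorem
(`hasCrossingLimit_triDomainCrossingProb_holds`), `P^{ℤ²}_N = (P^{ℤ²}_N − P^{𝕋}_N) + P^{𝕋}_N → 0 + F`.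
[folklore] -/
theorem halfStripGlue : Summit.CriticalPhenomena.CardyFormulaZ2.Theses.CardyPerronTeleport.HalfStripGlue := by
  intro hU hT ξ hξ h0 h3
  have ht := hT Literature.Probability.Percolation.hasCrossingLimit_triDomainCrossingProb_holds ξ hξ h0 h3
  have hsum := (hU ξ hξ h0 h3).add ht
  rw [zero_add] at hsum
  refine hsum.congr fun N ↦ ?_
  simp only [sub_add_cancel]

/-- **stmt-5178 ⟹ stmt-9321**: `HalfStripCardyZ2 → HalfPlaneWiredCardy` (target of route
CardyTotalPositivity). [folklore] -/
theorem halfPlaneWiredCardy_of_halfStripCardyZ2 :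
    Summit.CriticalPhenomena.CardyFormulaZ2.Theses.CardyPerronTeleport.HalfStripCardyZ2 →
      Summit.CriticalPhenomena.CardyFormulaZ2.Theses.CardyTotalPositivity.HalfPlaneWiredCardy :=
  fun h ↦ halfPlaneWiredCardy_of_collinearCardy (collinearCardy_of_halfStripCardyZ2 h)

/-- **stmt-5178 ⟹ stmt-5662**: `HalfStripCardyZ2 → HalfPlaneOneArmThird` (crux 6 of route
CardyBoundaryCoulombGas: the half-plane one-arm exponent `1/3` of bond-`ℤ²`). [folklore] -/
theorem halfPlaneOneArmThird_of_halfStripCardyZ2 :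
    Summit.CriticalPhenomena.CardyFormulaZ2.Theses.CardyPerronTeleport.HalfStripCardyZ2 →
      Summit.CriticalPhenomena.CardyFormulaZ2.Theses.CardyBoundaryCoulombGas.HalfPlaneOneArmThird :=
  fun h ↦ OneArm.halfPlaneOneArmThird_of_halfPlaneMarkDensityLaw (halfPlaneMarkDensityLaw_of_halfStripCardyZ2 h)

/-- The same for the route copy `CardyTotalPositivity.HalfPlaneOneArmThird`. [folklore] -/
theorem cardyTotalPositivity_halfPlaneOneArmThird_of_halfStripCardyZ2 :
    HalfStripCardyZ2 → Theses.CardyTotalPositivity.HalfPlaneOneArmThird :=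
  fun h ↦ OneArm.cardyTotalPositivity_halfPlaneOneArmThird_of_halfPlaneMarkDensityLaw
    (halfPlaneMarkDensityLaw_of_halfStripCardyZ2 h)

end Summit.CriticalPhenomena.CardyFormulaZ2.Cruxes.HalfPlaneMarkDensityLaw.SketchLine

end
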